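import Mathlib
import HarnessLib
import Literature.NumberTheory.LFunctions.RHWave0PNTProofs

/-!
# Counting tools for sums of three squareful numbers

Auxiliary file (theorems only) for the proof of Theorem 2 of Browning–Van Valckenborgh 2012
(`SquarefulSumsUpperBoundProofs`): the three elementary counting inputs of §4 of the paper
[cite: BrowningValckenborgh2012, §4].

* **Roots of unity in `ℤ/m`** (`SquarefulCount.natCard_sqrtOne_le`,
  `SquarefulCount.natCard_cubeRootsOfUnity_le`): `#{ρ : ρ² = 1} ≤ 2 · 2^{ω(m)}` and
  `#{ρ : ρ³ = 1} ≤ 3^{ω(m)}`, by the Chinese remainder theorem (`ZMod.chineseRemainder`), the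
  cyclicity of `(ℤ/q^j)ˣ` for odd primes `q` (Mathlib's `ZMod.isCyclic_units_of_prime_pow`,
  `IsCyclic.card_pow_eq_one_le`) and a direct treatment of `q = 2` (at most four square roots of
  unity modulo `2^j`; cube roots are trivial since `#(ℤ/2^j)ˣ` is a power of two). This is the
  source of the factors `d^{ω(c₁c₂c₃)}` of Lemma 3 of the paper.
* **Divisor sums** (`SquarefulCount.sum_two_pow_omega_le`, `SquarefulCount.sum_three_pow_omega_le`):
  `∑_{n ≤ N} 2^{ω(n)} ≤ N (1 + log N)` and `∑_{n ≤ N} 3^{ω(n)} ≤ N (1 + log N)²` ("the familiar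
  bound `∑_{n ≤ x} k^{ω(n)} ≪ x log^{k-1} x`" of the paper), via `2^ω ≤ τ`,
  `3^{ω(n)} ≤ ∑_{d ∣ n} 2^{ω(d)}`, `∑_{n ≤ N} τ(n) = ∑_d ⌊N/d⌋` and `harmonic_le_one_add_log`.
* **An auxiliary prime** (`SquarefulCount.exists_prime_Ioc_not_dvd`): for all large `x` and all
  `m ≥ 1` with `log m ≤ x/2` there is a prime `p ∈ (x, 2x]` not dividing `m` — from the prime
  number theorem `ϑ(x) ~ x` proved in this tree
  (`Literature.NumberTheory.LFunctions.chebyshevTheta_isEquivalent`): the primes in `(x, 2x]` have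
  product `exp(ϑ(2x) - ϑ(x)) ≥ exp(5x/8)`. This prime is the auxiliary modulus of the determinant
  method of `SquarefulSumsDetMethod`; choosing it coprime to the coefficients costs an additive
  `O(log B)`, which the final bound absorbs.

No definitions are introduced.
-/

namespace Literature.NumberTheory.DiophantineGeometry

namespace SquarefulCount

open Finset

/-! ### A1. Roots of unity in `ZMod m` -/

/-- In `ZMod m` the `d`-th roots of unity (`d ≠ 0`) inject into the units `u` with `u^d = 1`.
[folklore] -/
theorem natCard_rootsOfUnity_le_units {m d : ℕ} [NeZero m] (hd : d ≠ 0) :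
    Nat.card {ρ : ZMod m // ρ ^ d = 1} ≤ Nat.card {u : (ZMod m)ˣ // u ^ d = 1} := by
  refine Nat.card_le_card_of_injective
    (fun ρ => ⟨Units.ofPowEqOne ρ.1 d ρ.2 hd, Units.ext (by simp)⟩) ?_
  intro ρ ρ' h
  have := congrArg (fun u : {u : (ZMod m)ˣ // u ^ d = 1} => (u.1 : ZMod m)) h
  exact Subtype.ext (by simpa using this)

/-- For an odd prime power modulus the `d`-th roots of unity number at most `d` (the unit group
is cyclic). [folklore] -/
theorem natCard_rootsOfUnity_primePow_le {q j d : ℕ} (hq : q.Prime) (hq2 : q ≠ 2) (hd : 0 < d) :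
    Nat.card {ρ : ZMod (q ^ j) // ρ ^ d = 1} ≤ d := by
  classical
  haveI : NeZero (q ^ j) := ⟨pow_ne_zero _ hq.ne_zero⟩
  haveI := ZMod.isCyclic_units_of_prime_pow q hq hq2 j
  calc Nat.card {ρ : ZMod (q ^ j) // ρ ^ d = 1}
      ≤ Nat.card {u : (ZMod (q ^ j))ˣ // u ^ d = 1} := natCard_rootsOfUnity_le_units hd.ne'
    _ = #{u : (ZMod (q ^ j))ˣ | u ^ d = 1} := by
        rw [Nat.card_eq_fintype_card, Fintype.card_subtype]
    _ ≤ d := IsCyclic.card_pow_eq_one_le hd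

/-- Modulo a power of two, `1` is the only cube root of unity. [folklore] -/
theorem natCard_cubeRootsOfUnity_two_pow_le (j : ℕ) :
    Nat.card {ρ : ZMod (2 ^ j) // ρ ^ 3 = 1} ≤ 1 := by
  classical
  haveI : NeZero (2 ^ j) := ⟨pow_ne_zero _ two_ne_zero⟩
  refine (natCard_rootsOfUnity_le_units (by norm_num)).trans ?_
  have key : ∀ w : (ZMod (2 ^ j))ˣ, w ^ 3 = 1 → w = 1 := by
    intro w hw
    have hcard : w ^ Fintype.card (ZMod (2 ^ j))ˣ = 1 := pow_card_eq_one
    rw [ZMod.card_units_eq_totient] at hcard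
    have hg : Nat.gcd 3 (Nat.totient (2 ^ j)) = 1 := by
      rcases j with _ | j
      · simp
      · rw [Nat.totient_prime_pow Nat.prime_two (Nat.succ_pos _)]
        simpa using (Nat.Coprime.pow_right j (by decide : Nat.Coprime 3 2))
    have := pow_gcd_eq_one.mpr ⟨hw, hcard⟩
    rwa [hg, pow_one] at this
  haveI : Subsingleton {u : (ZMod (2 ^ j))ˣ // u ^ 3 = 1} :=
    ⟨fun u u' => Subtype.ext ((key u.1 u.2).trans (key u'.1 u'.2).symm)⟩
  exact Finite.card_le_one_iff_subsingleton.mpr inferInstance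

/-- Consecutive naturals are coprime. [folklore] -/
theorem coprime_self_add_one (s : ℕ) : Nat.Coprime s (s + 1) := by
  simp [Nat.coprime_self_add_right]

/-- Modulo a power of two there are at most four square roots of unity. [folklore] -/
theorem natCard_sqrtOne_two_pow_le (j : ℕ) : Nat.card {ρ : ZMod (2 ^ j) // ρ ^ 2 = 1} ≤ 4 := by
  classical
  haveI : NeZero (2 ^ j) := ⟨pow_ne_zero _ two_ne_zero⟩
  rcases le_or_gt j 2 with hj | hj
  · calc Nat.card {ρ : ZMod (2 ^ j) // ρ ^ 2 = 1} ≤ Nat.card (ZMod (2 ^ j)) :=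
          Finite.card_subtype_le _
      _ = 2 ^ j := Nat.card_zmod _
      _ ≤ 2 ^ 2 := Nat.pow_le_pow_right two_pos hj
      _ = 4 := rfl
  · obtain ⟨k, rfl⟩ : ∃ k, j = k + 3 := ⟨j - 3, by omega⟩
    set P : ℕ := 2 ^ (k + 1) with hP
    have hP0 : 0 < P := by positivity
    have hN : 2 ^ (k + 3) = 4 * P := by rw [hP]; ring
    have hPP : IsPrimePow P := Nat.prime_two.isPrimePow.pow (Nat.succ_ne_zero k)
    rw [Nat.card_eq_fintype_card, Fintype.card_subtype]
    calc #{ρ : ZMod (2 ^ (k + 3)) | ρ ^ 2 = 1}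
        ≤ #({1, 2 * P - 1, 2 * P + 1, 4 * P - 1} : Finset ℕ) := by
          refine Finset.card_le_card_of_injOn (fun ρ => ρ.val) (fun ρ hρ => ?_)
            (fun ρ _ ρ' _ h => ZMod.val_injective _ h)
          simp only [Finset.coe_filter, Finset.mem_univ, true_and, Set.mem_setOf_eq] at hρ
          simp only [Finset.coe_insert, Finset.coe_singleton, Set.mem_insert_iff,
            Set.mem_singleton_iff]
          set r : ℕ := ρ.val with hr
          have hrlt : r < 4 * P := by rw [← hN]; exact ZMod.val_lt ρ
          have hcast : ((r * r : ℕ) : ZMod (2 ^ (k + 3))) = ((1 : ℕ) : ZMod (2 ^ (k + 3))) := by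
            push_cast
            rw [hr, ZMod.natCast_zmod_val, ← pow_two, hρ]
          have hmod : r * r ≡ 1 [MOD 2 ^ (k + 3)] := (ZMod.natCast_eq_natCast_iff _ _ _).mp hcast
          have hr1 : 1 ≤ r := by
            rcases Nat.eq_zero_or_pos r with h0 | h0
            · exfalso
              rw [h0] at hmod
              have := (Nat.modEq_iff_dvd' (by norm_num)).mp hmod
              rw [hN] at this
              have h4 : 4 * P ≤ 1 - 0 * 0 := Nat.le_of_dvd (by norm_num) this
              omega
            · exact h0
          have hdvd : 4 * P ∣ r * r - 1 := by
            rw [← hN]; exact (Nat.modEq_iff_dvd' (Nat.one_le_iff_ne_zero.mpr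
              (Nat.mul_ne_zero (by omega) (by omega)))).mp hmod.symm
          rcases Nat.even_or_odd' r with ⟨s, hs | hs⟩
          · -- `r` even is impossible
            exfalso
            have hs1 : 1 ≤ s := by omega
            have h2 : (2 : ℕ) ∣ r * r - 1 := (dvd_mul_of_dvd_left (by norm_num) P).trans hdvd
            obtain ⟨t, ht⟩ : ∃ t, s * s = t := ⟨_, rfl⟩
            have ht1 : 1 ≤ t := by
              rw [← ht]; exact Nat.one_le_iff_ne_zero.mpr (Nat.mul_ne_zero (by omega) (by omega))
            have : r * r = 2 * (2 * t) := by rw [hs, ← ht]; ring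
            rw [this] at h2
            omega
          · have hss : r * r - 1 = 4 * (s * (s + 1)) := by
              have h' : (2 * s + 1) * (2 * s + 1) = 4 * (s * (s + 1)) + 1 := by ring
              rw [hs, h', Nat.add_sub_cancel]
            rw [hss] at hdvd
            have hP' : P ∣ s * (s + 1) := Nat.dvd_of_mul_dvd_mul_left (by norm_num) hdvd
            rcases ((coprime_self_add_one s).isPrimePow_dvd_mul hPP).mp hP' with ⟨t, ht⟩ | ⟨t, ht⟩
            · -- `s = P t`
              rcases Nat.lt_or_ge t 2 with ht2 | ht2
              · interval_cases t
                · left; omega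
                · right; right; left; omega
              · exfalso
                have := Nat.mul_le_mul_left P ht2
                omega
            · -- `s + 1 = P t`
              rcases Nat.lt_or_ge t 3 with ht3 | ht3
              · interval_cases t
                · omega
                · right; left; omega
                · right; right; right; omega
              · exfalso
                have := Nat.mul_le_mul_left P ht3
                omega
      _ ≤ 4 := Finset.card_le_four

/-- Multiplicativity (as an inequality) of the number of `d`-th roots of unity, by the Chinese
remainder theorem. [folklore] -/
theorem natCard_rootsOfUnity_mul_le {a b : ℕ} [NeZero a] [NeZero b] (hab : a.Coprime b) (d : ℕ) :
    Nat.card {ρ : ZMod (a * b) // ρ ^ d = 1} ≤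
      Nat.card {ρ : ZMod a // ρ ^ d = 1} * Nat.card {ρ : ZMod b // ρ ^ d = 1} := by
  rw [← Nat.card_prod]
  refine Nat.card_le_card_of_injective (fun ρ =>
    (⟨(ZMod.chineseRemainder hab ρ.1).1, ?_⟩, ⟨(ZMod.chineseRemainder hab ρ.1).2, ?_⟩)) ?_
  · have := congrArg (fun x => (ZMod.chineseRemainder hab x).1) ρ.2
    simpa using this
  · have := congrArg (fun x => (ZMod.chineseRemainder hab x).2) ρ.2
    simpa using this
  · intro ρ ρ' h
    simp only [Prod.mk.injEq, Subtype.mk.injEq] at h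
    exact Subtype.ext ((ZMod.chineseRemainder hab).injective (Prod.ext h.1 h.2))

/-- The number of cube roots of unity in `ZMod m` is at most `3^{ω(m)}`. [folklore] -/
theorem natCard_cubeRootsOfUnity_le (m : ℕ) (hm : 0 < m) :
    Nat.card {ρ : ZMod m // ρ ^ 3 = 1} ≤ 3 ^ m.primeFactors.card := by
  induction m using Nat.recOnPosPrimePosCoprime with
  | zero => exact absurd hm (lt_irrefl 0)
  | one =>
    simp only [Nat.primeFactors_one, Finset.card_empty, pow_zero]
    exact (Finite.card_subtype_le _).trans (by rw [Nat.card_zmod])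
  | prime_pow q j hq hj =>
    rw [Nat.primeFactors_prime_pow hj.ne' hq, Finset.card_singleton, pow_one]
    by_cases hq2 : q = 2
    · subst hq2
      exact (natCard_cubeRootsOfUnity_two_pow_le j).trans (by norm_num)
    · exact natCard_rootsOfUnity_primePow_le hq hq2 (by norm_num)
  | coprime a b ha hb hab iha ihb =>
    haveI : NeZero a := ⟨by omega⟩
    haveI : NeZero b := ⟨by omega⟩
    rw [Nat.Coprime.primeFactors_mul hab, Finset.card_union_of_disjoint hab.disjoint_primeFactors,
      pow_add]
    exact (natCard_rootsOfUnity_mul_le hab _).trans (Nat.mul_le_mul (iha (by omega)) (ihb (by omega)))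

/-- The number of square roots of unity in `ZMod m` is at most `2^{ω(m) + [2 ∣ m]}`.
[folklore] -/
theorem natCard_sqrtOne_le' (m : ℕ) (hm : 0 < m) :
    Nat.card {ρ : ZMod m // ρ ^ 2 = 1} ≤ 2 ^ (m.primeFactors.card + if Even m then 1 else 0) := by
  induction m using Nat.recOnPosPrimePosCoprime with
  | zero => exact absurd hm (lt_irrefl 0)
  | one =>
    simp only [Nat.primeFactors_one, Finset.card_empty, Nat.not_even_one, if_false, add_zero,
      pow_zero]
    exact (Finite.card_subtype_le _).trans (by rw [Nat.card_zmod])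
  | prime_pow q j hq hj =>
    rw [Nat.primeFactors_prime_pow hj.ne' hq, Finset.card_singleton]
    by_cases hq2 : q = 2
    · subst hq2
      have he : Even (2 ^ j) := Nat.even_pow.mpr ⟨even_two, hj.ne'⟩
      simp only [he, if_true]
      exact natCard_sqrtOne_two_pow_le j
    · have he : ¬ Even (q ^ j) := fun h => hq2 ((Nat.Prime.even_iff hq).mp (Nat.even_pow.mp h).1)
      simp only [he, if_false, add_zero, pow_one]
      exact natCard_rootsOfUnity_primePow_le hq hq2 two_pos
  | coprime a b ha hb hab iha ihb =>
    haveI : NeZero a := ⟨by omega⟩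
    haveI : NeZero b := ⟨by omega⟩
    have hnot : ¬ (Even a ∧ Even b) := fun ⟨h1, h2⟩ => by
      have h := Nat.dvd_gcd (even_iff_two_dvd.mp h1) (even_iff_two_dvd.mp h2)
      rw [Nat.Coprime.gcd_eq_one hab] at h
      omega
    have key : (a * b).primeFactors.card + (if Even (a * b) then 1 else 0) =
        (a.primeFactors.card + if Even a then 1 else 0) +
        (b.primeFactors.card + if Even b then 1 else 0) := by
      rw [Nat.Coprime.primeFactors_mul hab, Finset.card_union_of_disjoint hab.disjoint_primeFactors]
      by_cases h1 : Even a <;> by_cases h2 : Even b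
      · exact absurd ⟨h1, h2⟩ hnot
      · simp [h1, h2]; ring
      · simp [h1, h2]; ring
      · simp [Nat.even_mul, h1, h2]
    rw [key, pow_add]
    exact (natCard_rootsOfUnity_mul_le hab 2).trans (Nat.mul_le_mul (iha (by omega)) (ihb (by omega)))

/-- The number of square roots of unity in `ZMod m` is at most `2 · 2^{ω(m)}`. [folklore] -/
theorem natCard_sqrtOne_le (m : ℕ) (hm : 0 < m) :
    Nat.card {ρ : ZMod m // ρ ^ 2 = 1} ≤ 2 * 2 ^ m.primeFactors.card := by
  refine (natCard_sqrtOne_le' m hm).trans ?_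
  rw [pow_add, mul_comm]
  gcongr
  split_ifs <;> norm_num

/-! ### A2. Divisor sums: `∑ 2^ω ≪ N log N`, `∑ 3^ω ≪ N log² N` -/

/-- `2^{ω(n)} ≤ τ(n)`: the square-free divisors are divisors. [folklore] -/
theorem two_pow_card_primeFactors_le_card_divisors (n : ℕ) (hn : n ≠ 0) :
    2 ^ n.primeFactors.card ≤ n.divisors.card := by
  classical
  rw [← Finset.card_powerset]
  refine Finset.card_le_card_of_injOn (fun T => ∏ p ∈ T, p) (fun T hT => ?_) (fun T hT T' hT' h => ?_)
  · rw [Finset.mem_coe, Finset.mem_powerset] at hT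
    rw [Finset.mem_coe, Nat.mem_divisors]
    exact ⟨(Finset.prod_dvd_prod_of_subset _ _ _ hT).trans (Nat.prod_primeFactors_dvd n), hn⟩
  · rw [Finset.mem_coe, Finset.mem_powerset] at hT hT'
    have h1 := Nat.primeFactors_prod (s := T) fun p hp => Nat.prime_of_mem_primeFactors (hT hp)
    have h2 := Nat.primeFactors_prod (s := T') fun p hp => Nat.prime_of_mem_primeFactors (hT' hp)
    rw [← h1, ← h2]
    exact congrArg Nat.primeFactors h

/-- `3^{ω(n)} ≤ ∑_{d ∣ n} 2^{ω(d)}` (restrict to square-free `d`). [folklore] -/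
theorem three_pow_card_primeFactors_le (n : ℕ) (hn : n ≠ 0) :
    (3 : ℝ) ^ n.primeFactors.card ≤ ∑ d ∈ n.divisors, (2 : ℝ) ^ d.primeFactors.card := by
  classical
  have h3 : (3 : ℝ) ^ n.primeFactors.card =
      ∑ T ∈ n.primeFactors.powerset, (2 : ℝ) ^ T.card := by
    rw [show (3 : ℝ) = 2 + 1 by norm_num, ← Finset.sum_pow_mul_eq_add_pow]
    simp
  rw [h3]
  have hinj : Set.InjOn (fun T : Finset ℕ => ∏ p ∈ T, p) ↑(n.primeFactors.powerset) := by
    intro T hT T' hT' h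
    rw [Finset.mem_coe, Finset.mem_powerset] at hT hT'
    have h1 := Nat.primeFactors_prod (s := T) fun p hp => Nat.prime_of_mem_primeFactors (hT hp)
    have h2 := Nat.primeFactors_prod (s := T') fun p hp => Nat.prime_of_mem_primeFactors (hT' hp)
    rw [← h1, ← h2]
    exact congrArg Nat.primeFactors h
  have hT : ∀ T ∈ n.primeFactors.powerset, (2 : ℝ) ^ T.card =
      (2 : ℝ) ^ (∏ p ∈ T, p).primeFactors.card := by
    intro T hT
    rw [Finset.mem_powerset] at hT
    rw [Nat.primeFactors_prod fun p hp => Nat.prime_of_mem_primeFactors (hT hp)]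
  rw [Finset.sum_congr rfl hT, ← Finset.sum_image (g := fun T : Finset ℕ => ∏ p ∈ T, p)
    (f := fun d => (2 : ℝ) ^ d.primeFactors.card) hinj]
  refine Finset.sum_le_sum_of_subset_of_nonneg (fun d hd => ?_) (fun _ _ _ => by positivity)
  obtain ⟨T, hT, rfl⟩ := Finset.mem_image.mp hd
  rw [Finset.mem_powerset] at hT
  rw [Nat.mem_divisors]
  exact ⟨(Finset.prod_dvd_prod_of_subset _ _ _ hT).trans (Nat.prod_primeFactors_dvd n), hn⟩

/-- The number of multiples of `d` in `[1, N]` is `⌊N/d⌋`. [folklore] -/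
theorem card_Icc_filter_dvd (N d : ℕ) : #{n ∈ Finset.Icc 1 N | d ∣ n} = N / d := by
  rw [show Finset.Icc 1 N = Finset.Ioc 0 N from Finset.Icc_add_one_left_eq_Ioc 0 N]
  exact Nat.Ioc_filter_dvd_card_eq_div N d

/-- **Dirichlet's bound, crude form**: `∑_{n ≤ N} τ(n) ≤ N (1 + log N)`. [folklore] -/
theorem sum_card_divisors_le (N : ℕ) :
    ∑ n ∈ Finset.Icc 1 N, (n.divisors.card : ℝ) ≤ N * (1 + Real.log N) := by
  classical
  have h1 : ∀ n ∈ Finset.Icc 1 N, (n.divisors.card : ℝ) ≤ #{d ∈ Finset.Icc 1 N | d ∣ n} := by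
    intro n hn
    rw [Finset.mem_Icc] at hn
    exact_mod_cast Finset.card_le_card fun d hd => by
      rw [Nat.mem_divisors] at hd
      rw [Finset.mem_filter, Finset.mem_Icc]
      exact ⟨⟨Nat.pos_of_dvd_of_pos hd.1 (by omega), (Nat.le_of_dvd (by omega) hd.1).trans hn.2⟩,
        hd.1⟩
  calc ∑ n ∈ Finset.Icc 1 N, (n.divisors.card : ℝ)
      ≤ ∑ n ∈ Finset.Icc 1 N, (#{d ∈ Finset.Icc 1 N | d ∣ n} : ℝ) := Finset.sum_le_sum h1
    _ = ∑ d ∈ Finset.Icc 1 N, (#{n ∈ Finset.Icc 1 N | d ∣ n} : ℝ) := by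
        simp only [Finset.card_filter, Nat.cast_sum]
        rw [Finset.sum_comm]
    _ = ∑ d ∈ Finset.Icc 1 N, ((N / d : ℕ) : ℝ) := by simp_rw [card_Icc_filter_dvd]
    _ ≤ ∑ d ∈ Finset.Icc 1 N, (N : ℝ) * (d : ℝ)⁻¹ := by
        refine Finset.sum_le_sum fun d hd => ?_
        rw [← div_eq_mul_inv]
        exact Nat.cast_div_le
    _ = N * ∑ d ∈ Finset.Icc 1 N, (d : ℝ)⁻¹ := by rw [Finset.mul_sum]
    _ ≤ N * (1 + Real.log N) := by
        gcongr
        -- `∑_{n ≤ N} 1/n ≤ 1 + log N` (Mathlib's `harmonic_le_one_add_log`)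
        have h := harmonic_le_one_add_log N
        rw [harmonic_eq_sum_Icc] at h
        push_cast at h
        exact h

/-- `∑_{n ≤ N} 2^{ω(n)} ≤ N (1 + log N)`. [folklore] -/
theorem sum_two_pow_omega_le (N : ℕ) :
    ∑ n ∈ Finset.Icc 1 N, (2 : ℝ) ^ n.primeFactors.card ≤ N * (1 + Real.log N) := by
  refine le_trans (Finset.sum_le_sum fun n hn => ?_) (sum_card_divisors_le N)
  rw [Finset.mem_Icc] at hn
  exact_mod_cast two_pow_card_primeFactors_le_card_divisors n (by omega)

/-- `∑_{d ≤ N, e ∣ d} 1/d ≤ (1/e) ∑_{m ≤ N} 1/m`. [folklore] -/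
theorem sum_inv_filter_dvd_le (N e : ℕ) (he : 0 < e) :
    ∑ d ∈ Finset.Icc 1 N with e ∣ d, (d : ℝ)⁻¹ ≤ (e : ℝ)⁻¹ * ∑ m ∈ Finset.Icc 1 N, (m : ℝ)⁻¹ := by
  classical
  have hinj : Set.InjOn (fun d => d / e) ↑({d ∈ Finset.Icc 1 N | e ∣ d}) := by
    intro d hd d' hd' h
    simp only [Finset.coe_filter, Finset.mem_Icc, Set.mem_setOf_eq] at hd hd'
    have := congrArg (· * e) h
    simpa only [Nat.div_mul_cancel hd.2, Nat.div_mul_cancel hd'.2] using this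
  calc ∑ d ∈ Finset.Icc 1 N with e ∣ d, (d : ℝ)⁻¹
      = ∑ d ∈ Finset.Icc 1 N with e ∣ d, (e : ℝ)⁻¹ * ((d / e : ℕ) : ℝ)⁻¹ := by
        refine Finset.sum_congr rfl fun d hd => ?_
        simp only [Finset.mem_filter, Finset.mem_Icc] at hd
        rw [← mul_inv, ← Nat.cast_mul, Nat.mul_div_cancel' hd.2]
    _ = (e : ℝ)⁻¹ * ∑ d ∈ Finset.Icc 1 N with e ∣ d, ((d / e : ℕ) : ℝ)⁻¹ := by rw [Finset.mul_sum]
    _ = (e : ℝ)⁻¹ * ∑ m ∈ ({d ∈ Finset.Icc 1 N | e ∣ d}).image (fun d => d / e), (m : ℝ)⁻¹ := by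
        rw [Finset.sum_image hinj]
    _ ≤ (e : ℝ)⁻¹ * ∑ m ∈ Finset.Icc 1 N, (m : ℝ)⁻¹ := by
        refine mul_le_mul_of_nonneg_left
          (Finset.sum_le_sum_of_subset_of_nonneg (fun m hm => ?_) (fun _ _ _ => by positivity))
          (by positivity)
        obtain ⟨d, hd, rfl⟩ := Finset.mem_image.mp hm
        simp only [Finset.mem_filter, Finset.mem_Icc] at hd
        rw [Finset.mem_Icc]
        exact ⟨Nat.div_pos (Nat.le_of_dvd (by omega) hd.2) he,
          (Nat.div_le_self _ _).trans hd.1.2⟩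

/-- `∑_{d ≤ N} τ(d)/d ≤ (1 + log N)²`. [folklore] -/
theorem sum_card_divisors_div_le (N : ℕ) :
    ∑ d ∈ Finset.Icc 1 N, (d.divisors.card : ℝ) * (d : ℝ)⁻¹ ≤ (1 + Real.log N) ^ 2 := by
  classical
  have h1 : ∀ d ∈ Finset.Icc 1 N, (d.divisors.card : ℝ) * (d : ℝ)⁻¹ ≤
      ∑ e ∈ Finset.Icc 1 N, if e ∣ d then (d : ℝ)⁻¹ else 0 := by
    intro d hd
    rw [Finset.mem_Icc] at hd
    have hsub : d.divisors ⊆ {e ∈ Finset.Icc 1 N | e ∣ d} := fun e he => by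
      rw [Nat.mem_divisors] at he
      rw [Finset.mem_filter, Finset.mem_Icc]
      exact ⟨⟨Nat.pos_of_dvd_of_pos he.1 (by omega), (Nat.le_of_dvd (by omega) he.1).trans hd.2⟩,
        he.1⟩
    have hcard : (d.divisors.card : ℝ) ≤ #{e ∈ Finset.Icc 1 N | e ∣ d} := by
      exact_mod_cast Finset.card_le_card hsub
    calc (d.divisors.card : ℝ) * (d : ℝ)⁻¹ ≤ (#{e ∈ Finset.Icc 1 N | e ∣ d} : ℝ) * (d : ℝ)⁻¹ :=
          mul_le_mul_of_nonneg_right hcard (by positivity)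
      _ = ∑ e ∈ Finset.Icc 1 N, if e ∣ d then (d : ℝ)⁻¹ else 0 := by
          rw [← Finset.sum_filter, Finset.sum_const, nsmul_eq_mul]
  calc ∑ d ∈ Finset.Icc 1 N, (d.divisors.card : ℝ) * (d : ℝ)⁻¹
      ≤ ∑ d ∈ Finset.Icc 1 N, ∑ e ∈ Finset.Icc 1 N, if e ∣ d then (d : ℝ)⁻¹ else 0 :=
        Finset.sum_le_sum h1
    _ = ∑ e ∈ Finset.Icc 1 N, ∑ d ∈ Finset.Icc 1 N with e ∣ d, (d : ℝ)⁻¹ := by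
        rw [Finset.sum_comm]
        simp only [Finset.sum_filter]
    _ ≤ ∑ e ∈ Finset.Icc 1 N, (e : ℝ)⁻¹ * ∑ m ∈ Finset.Icc 1 N, (m : ℝ)⁻¹ := by
        refine Finset.sum_le_sum fun e he => ?_
        rw [Finset.mem_Icc] at he
        exact sum_inv_filter_dvd_le N e (by omega)
    _ = (∑ e ∈ Finset.Icc 1 N, (e : ℝ)⁻¹) * ∑ m ∈ Finset.Icc 1 N, (m : ℝ)⁻¹ := by
        rw [Finset.sum_mul]
    _ ≤ (1 + Real.log N) * (1 + Real.log N) := by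
        have h0 : 0 ≤ ∑ e ∈ Finset.Icc 1 N, (e : ℝ)⁻¹ := Finset.sum_nonneg fun _ _ => by positivity
        have hh : ∑ n ∈ Finset.Icc 1 N, (n : ℝ)⁻¹ ≤ 1 + Real.log N := by
          have h := harmonic_le_one_add_log N
          rw [harmonic_eq_sum_Icc] at h
          push_cast at h
          exact h
        exact mul_le_mul hh hh h0 (h0.trans hh)
    _ = (1 + Real.log N) ^ 2 := by ring

/-- `∑_{n ≤ N} 3^{ω(n)} ≤ N (1 + log N)²`. [folklore] -/
theorem sum_three_pow_omega_le (N : ℕ) :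
    ∑ n ∈ Finset.Icc 1 N, (3 : ℝ) ^ n.primeFactors.card ≤ N * (1 + Real.log N) ^ 2 := by
  classical
  have h1 : ∀ n ∈ Finset.Icc 1 N, (3 : ℝ) ^ n.primeFactors.card ≤
      ∑ d ∈ Finset.Icc 1 N, if d ∣ n then (2 : ℝ) ^ d.primeFactors.card else 0 := by
    intro n hn
    rw [Finset.mem_Icc] at hn
    refine (three_pow_card_primeFactors_le n (by omega)).trans ?_
    rw [← Finset.sum_filter]
    refine Finset.sum_le_sum_of_subset_of_nonneg (fun d hd => ?_) (fun _ _ _ => by positivity)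
    rw [Nat.mem_divisors] at hd
    rw [Finset.mem_filter, Finset.mem_Icc]
    exact ⟨⟨Nat.pos_of_dvd_of_pos hd.1 (by omega), (Nat.le_of_dvd (by omega) hd.1).trans hn.2⟩, hd.1⟩
  calc ∑ n ∈ Finset.Icc 1 N, (3 : ℝ) ^ n.primeFactors.card
      ≤ ∑ n ∈ Finset.Icc 1 N, ∑ d ∈ Finset.Icc 1 N,
          if d ∣ n then (2 : ℝ) ^ d.primeFactors.card else 0 := Finset.sum_le_sum h1
    _ = ∑ d ∈ Finset.Icc 1 N, (2 : ℝ) ^ d.primeFactors.card * #{n ∈ Finset.Icc 1 N | d ∣ n} := by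
        rw [Finset.sum_comm]
        refine Finset.sum_congr rfl fun d _ => ?_
        rw [← Finset.sum_filter, Finset.sum_const, nsmul_eq_mul, mul_comm]
    _ = ∑ d ∈ Finset.Icc 1 N, (2 : ℝ) ^ d.primeFactors.card * ((N / d : ℕ) : ℝ) := by
        simp_rw [card_Icc_filter_dvd]
    _ ≤ ∑ d ∈ Finset.Icc 1 N, (2 : ℝ) ^ d.primeFactors.card * ((N : ℝ) * (d : ℝ)⁻¹) := by
        refine Finset.sum_le_sum fun d hd => ?_
        gcongr
        rw [← div_eq_mul_inv]
        exact Nat.cast_div_le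
    _ = N * ∑ d ∈ Finset.Icc 1 N, (2 : ℝ) ^ d.primeFactors.card * (d : ℝ)⁻¹ := by
        rw [Finset.mul_sum]
        refine Finset.sum_congr rfl fun d _ => ?_
        ring
    _ ≤ N * ∑ d ∈ Finset.Icc 1 N, (d.divisors.card : ℝ) * (d : ℝ)⁻¹ := by
        gcongr with d hd
        rw [Finset.mem_Icc] at hd
        exact_mod_cast two_pow_card_primeFactors_le_card_divisors d (by omega)
    _ ≤ N * (1 + Real.log N) ^ 2 := by gcongr; exact sum_card_divisors_div_le N

/-! ### A3. An auxiliary prime in `(x, 2x]` not dividing a given integer -/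

/-- From the prime number theorem `ϑ(x) ~ x` (in the tree): for all large `x` and every `m ≥ 1`
with `log m ≤ x/2` there is a prime `p ∈ (x, 2x]` with `p ∤ m` (the primes in `(x, 2x]` have
product `exp(ϑ(2x) - ϑ(x)) ≥ exp(5x/8) > m`). [folklore] -/
theorem exists_prime_Ioc_not_dvd :
    ∃ N₀ : ℝ, 0 < N₀ ∧ ∀ x : ℝ, N₀ ≤ x → ∀ m : ℕ, m ≠ 0 → Real.log m ≤ x / 2 →
      ∃ p : ℕ, p.Prime ∧ x < p ∧ (p : ℝ) ≤ 2 * x ∧ ¬ p ∣ m := by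
  classical
  have hθ := Literature.NumberTheory.LFunctions.chebyshevTheta_isEquivalent
  have hbound := hθ.isLittleO.bound (show (0 : ℝ) < 1 / 8 by norm_num)
  obtain ⟨N₁, hN₁⟩ := Filter.eventually_atTop.mp hbound
  refine ⟨max N₁ 1, by positivity, fun x hx m hm hlog => ?_⟩
  have hx1 : 1 ≤ x := le_trans (le_max_right _ _) hx
  have hxN : N₁ ≤ x := le_trans (le_max_left _ _) hx
  have hx0 : 0 < x := by linarith
  -- `ϑ(2x) - ϑ(x) ≥ 5x/8`
  have h2x := hN₁ (2 * x) (by linarith)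
  have h1x := hN₁ x hxN
  simp only [Pi.sub_apply, Real.norm_eq_abs] at h2x h1x
  rw [abs_of_pos (by linarith : (0 : ℝ) < 2 * x)] at h2x
  rw [abs_of_pos hx0] at h1x
  have hdiff : 5 * x / 8 ≤ Chebyshev.theta (2 * x) - Chebyshev.theta x := by
    have := (abs_le.mp h2x).1
    have := (abs_le.mp h1x).2
    linarith
  -- the primes in `(⌊x⌋₊, ⌊2x⌋₊]`
  set S := (Finset.Ioc ⌊x⌋₊ ⌊2 * x⌋₊).filter Nat.Prime with hS
  have hθS : Chebyshev.theta (2 * x) - Chebyshev.theta x = ∑ p ∈ S, Real.log p := by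
    have hfl : ⌊x⌋₊ ≤ ⌊2 * x⌋₊ := Nat.floor_le_floor (by linarith)
    rw [Chebyshev.theta, Chebyshev.theta, Finset.sum_filter, Finset.sum_filter, hS,
      Finset.sum_filter, ← Finset.sum_Ioc_consecutive _ (Nat.zero_le _) hfl]
    ring
  by_contra hcon
  push Not at hcon
  have hall : ∀ p ∈ S, p ∣ m := by
    intro p hp
    rw [hS, Finset.mem_filter, Finset.mem_Ioc] at hp
    refine hcon p hp.2 ?_ ?_
    · calc x < (⌊x⌋₊ : ℝ) + 1 := Nat.lt_floor_add_one x
        _ ≤ p := by exact_mod_cast hp.1.1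
    · calc (p : ℝ) ≤ ⌊2 * x⌋₊ := by exact_mod_cast hp.1.2
        _ ≤ 2 * x := Nat.floor_le (by linarith)
  have hprod : ∏ p ∈ S, p ∣ m := Finset.prod_primes_dvd m
    (fun p hp => Nat.prime_iff.mp (Finset.mem_filter.mp hp).2) hall
  have hprod_le : ((∏ p ∈ S, p : ℕ) : ℝ) ≤ m := by exact_mod_cast Nat.le_of_dvd (Nat.pos_of_ne_zero hm) hprod
  have hprod_pos : (0 : ℝ) < ((∏ p ∈ S, p : ℕ) : ℝ) := by
    have : 0 < ∏ p ∈ S, p := Finset.prod_pos fun p hp => (Finset.mem_filter.mp hp).2.pos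
    exact_mod_cast this
  have hlogprod : ∑ p ∈ S, Real.log p = Real.log ((∏ p ∈ S, p : ℕ) : ℝ) := by
    rw [Nat.cast_prod, Real.log_prod]
    intro p hp
    exact_mod_cast (Finset.mem_filter.mp hp).2.ne_zero
  have : ∑ p ∈ S, Real.log p ≤ Real.log m := by
    rw [hlogprod]; exact Real.log_le_log hprod_pos hprod_le
  linarith

end SquarefulCount

end Literature.NumberTheory.DiophantineGeometry
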